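import Summits.BirchSwinnertonDyer.Rank1Residual.P2.ShuZhaiThirtySixAdmissible
import Summits.BirchSwinnertonDyer.Rank1Residual.WAll.Target
import Summits.BirchSwinnertonDyer.Rank1Residual.Partition.CornersCMDecide
import HarnessLib

/-!
# Cell `bsd-print-cf2` (D-0131 (2) PRINT TIER, leaf CornerF @ `p = 2`), prover p3 — file 3/3: the
# Shu–Zhai 2021 quadratic-twist family of `36a1` (`j = 0`, CM by `ℤ[ζ₃]`) as a BY-NAME SLICE of the
# W-ALL leaf `WAllCornerFTwo` (CM, `ord_{s=1} L(E,s) = 1` ⇒ `BSD(E,2)`)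

HONEST FRAMING. The leaf `Summit.BirchSwinnertonDyer.WAllCornerFTwo` (every CM curve of analytic rank
one satisfies Miller's `BSD(E,2)`) is OPEN AS A CLASS. This file closes nothing class-wide: it states, in
the leaf's own shape `∀ W [IsElliptic] [IsGloballyMinimal], W.HasCM → W.analyticRank = 1 → ⟨W is a
globally minimal model of a member of the family⟩ → BSDp W 2`, ONE explicit infinite family of CM curves
with `j = 0` (CM field `ℚ(√−3)`, in which `2` is INERT; the members are additive at `2`, so the pairs
`(W, 2)` lie in the SHARP corner `CornerF♯`) on which the `2`-part of BSD is IN PRINT: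

> Shu–Zhai, *Generalized Birch lemma and the 2-part of the Birch and Swinnerton-Dyer conjecture for
> certain elliptic curves*, J. reine angew. Math. 775 (2021) 117–143, Thm 1.2 + Thm 1.4 (= Thm 4.10),
> applied to `E = 36a1` (`y² = x³ + 1`), which is row `36a1` of their own Table (§5.2, "E/ℚ satisfying
> f([0]) ∉ 2E(ℚ) and Condition (Tor) with conductor N < 100": `ℚ(E[2]) = ℚ(√−3)`,
> `ℚ(E′[2]) = ℚ(√3)`, admissible primes `q = 5, 17, 29, 41, 53, 89, …` (`q ≡ 5 (mod 12)`), primes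
> `p = 23, 47, 71, 167, 191, 239, …` (`p ≡ 23 (mod 24)`: `p ≡ 7 (mod 8)` and `2, 3` split in
> `ℚ(√−p)`)).

THE FAMILY: the quadratic twists `E^{(−pM)}` of `36a1` with `p ≡ 23 (mod 24)` prime and
`M = q₁* ⋯ q_r*` (`r ≥ 0`) a product of distinct admissible primes `≠ p` with every prime of `2N = 72`
split in `ℚ(√M)`; in coordinates `E^{(d)} : y² = x³ − 3d x² + 3d² x ≅ Y² = X³ + d³` (`X = x − d`). By
Thm 1.2 `ord_{s=1} L(E^{(−pM)}, s) = rk = 1`, by Thm 4.10 `Ш(E^{(−pM)})` is finite of odd order and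
`ord₂ (L′(E^{(−pM)},1)/(Ω R)) = r`, and by Thm 1.4 the `2`-part of BSD for `E^{(−pM)}` follows from the
`2`-part of BSD for `E = 36a1` — which is the CM rank-ZERO row C8 (Rubin 1991 / Burungale–Flach 2024,
tree fact `bsdTriple_of_hasCM_of_L_one_ne_zero`; `L(36a1, 1) ≠ 0` is itself a consequence of Thm 1.2
at `r = 0`, `P2.base_rankZero_of_shuZhai`). The simplest sub-family (`r = 0`):
`y² = x³ − p³`-type twists `36a1^{(−p)}`, `p ≡ 23 (mod 24)` — NO admissibility datum at all.

WHAT IS DISCHARGED IN THE KERNEL (files 1/3 `P2/ShuZhaiThirtySixCurve`, 2/3 `P2/ShuZhaiThirtySixAdmissible`): for the two-torsion normal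
form `E : y² = x³ − 3x² + 3x`
of `36a1` (`= [0,0,0,0,1]` shifted by `x ↦ x − 1`; same discriminant `−2⁴·3³`, globally minimal):
`E` elliptic, globally minimal, `j = 0` hence CM (`hasCM_of_j_eq_zero`); the rational `2`-isogeny
`E → E′ = E/E[2](ℚ)`, `E′ : y² = x³ + 6x² − 3x` (Vélu / Silverman III.4.5, tree `twoIsogeny`, degree `2`
PROVED); (Tor) `#E(ℚ)[2] = 2 = #E′(ℚ)[2]` (reduction modulo the good prime `5`, tree
`Rank2Observatory.twoTorsion_eq_zero_or_eq`); `N_E ∣ 432` (Ogg, tree `conductorNorm_dvd_of_localBounds`),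
hence "every prime of `N` (resp. `2N`) splits in `ℚ(√−p)`" for `p ≡ 23 (mod 24)` (decomposition law,
`satisfiesHeegnerHypothesis_iff_kronecker`, `d_{ℚ(√−p)} = −p`); CM of every model of every twist;
admissibility of every prime `q ≡ 5 (mod 12)` and the `ℚ(√M)`-condition for `M = ∏ q ≡ 1 (mod 24)`.

WHAT REMAINS AS EXPLICIT HYPOTHESES (nothing hidden): (a) the named published facts BY NAME —
`ShuZhai2021.thm12_ranks_of_twists` (Thm 1.2), `ShuZhai2021.thm14_twoPartBSD_of_twists` (Thm 1.4),
`bsdTriple_of_hasCM_of_L_one_ne_zero` (row C8), `hasEntireLFunction_rat` (modularity), and — for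
hypothesis (i) of Thm 1.4, "odd Manin constant" — `AgasheRibetStein2006.cremona_abs_maninConstant_eq_one
_of_level_le` (Thm 2.6: `c = 1` for optimal curves of conductor `≤ 130000`; `N(36a1) ∣ 432`; file 1/3
`not_two_dvd_c_of_isOptimalDatum_curve36a1`; the pair theorems keep the raw binder `hc`); (b) the TWO
DISPLAY hypotheses on the optimal parametrisation `X₀(36) → E` that print asserts for `36a1` (Shu–Zhai
§5.2 Table, row `36a1`; Cremona: `36a1` is the `Γ₀(36)`-optimal curve) and the kernel cannot evaluate:
a datum `Dt` with the lattice equality (`IsOptimalDatum`) and `f([0]) ∉ 2E(ℚ)` (`CuspZeroNotInTwice`). In the general slice the admissibility of `Q` and the `ℚ(√M)`-condition stay as printed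
(`IsAdmissible`, `AllPrimesSplitInSqrt`); the EXPLICIT slice takes `Q` = any finite set of primes
`≡ 5 (mod 12)` with `∏ q ≡ 1 (mod 24)` (both conditions then discharged, file 2/3); `r = 0` needs nothing.

Strategy sentence of the seat (p3): «cube sums: √−3-isogeny descent + Cai–Shu–Tian explicit
Gross–Zagier ⇒ r1 2- and 3-parts». REPORT «beyond-print theorem: NO» — this is Shu–Zhai's printed
theorem (their method: Cai–Shu–Tian's explicit Gross–Zagier formula on `X₀(36)` + the generalized Birch
lemma + `2`-descent) read on the leaf. For the CUBE-SUM curves proper (`x³ + y³ = n`, Sylvester /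
Satgé families `C_p`, `C_{2p}`, `C_{2p²}`, `C_{3p}`, `C_{3p²}`) NOTHING is in print at `ℓ = 2`
(Cai–Shu–Tian 2017 Thm 1.2 excludes `ℓ ∣ 2p`; Kezuka–Li 2020 Cor 1.2 is the `3`-part, Thm 1.3 a
`Ш[2]`-criterion; Hu–Shu–Yin 2019 p. 3: "for ℓ = 2, 3 … no results"; Shu–Yin 2022: `3`-part): their
`BSD₂` is the typed O12 residual `P2.CMRankOneHeegnerIndexAtTwo` (`X12/CubeSumSylvesterAtTwo`).

References: [ShuZhai2021] Thm 1.2, Thm 1.4, Thm 4.10, Def 1.1, §5.2 Table (arXiv:2102.11808 chunks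
p0003, p0013, p0014 L87); [BurungaleFlach2024] Thm 1.1 + Cor 2; [Miller2011LMS] Def 1.1;
[SilvermanAEC2009] III.4 Ex 4.5, VII.1 Rem 1.1, VII.3.1(b); [Cremona1997] Table 1 (36a);
tree files cited inline.
-/

noncomputable section

open scoped Classical

open WeierstrassCurve NumberField Literature.NumberTheory.EllipticCurves
  Literature.NumberTheory.EllipticCurves.Rank1Residual
  Literature.NumberTheory.EllipticCurves.ModularForms
  Literature.NumberTheory.EllipticCurves.ShuZhai2021
  Literature.NumberTheory.EllipticCurves.Rank1Residual.X11RankOneCertificates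
  Summit.BirchSwinnertonDyer.Rank1Residual
  Summit.BirchSwinnertonDyer.BirchSwinnertonDyer.Theorems.ConductorBoundOfBadPrimes

set_option autoImplicit false

namespace Summit.BirchSwinnertonDyer.Rank1Residual.P2

/-! ## §6 The base pair `(36a1, 2)`: analytic rank `0` (from Thm 1.2) and `BSD(36a1, 2)` (row C8) -/

/-- **`ord_{s=1} L(36a1, s) = 0`**, DERIVED from Shu–Zhai Thm 1.2 at `r = 0` (`E^{(1)} ≅ E`; in print:
"`f([0]) ∉ 2E(ℚ)` forces `L(E,1) ≠ 0`"), given the display hypotheses and one prime `p ≡ 23 (mod 24)`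
(e.g. `p = 23`). [cite: ShuZhai2021, Thm. 1.2] -/
theorem analyticRank_curve36a1_eq_zero (h12 : thm12_ranks_of_twists)
    (Dt : ModularParametrizationData curve36a1 (curve36a1.conductorNorm ℤ))
    (hopt : IsOptimalDatum curve36a1 Dt) (hcusp : CuspZeroNotInTwice curve36a1 Dt)
    {p : ℕ} (hp : p.Prime) (h24 : p % 24 = 23) : curve36a1.analyticRank = 0 :=
  (P2.base_rankZero_of_shuZhai h12
    (thm12Setting_curve36a1 Dt hopt hcusp hp h24 (Q := ∅) (fun q hq => absurd hq (Finset.notMem_empty q)))).1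

/-- **`BSD(36a1, 2)`** — the CERTIFIED BASE: `36a1` has CM and analytic rank `0`, so row C8 (Rubin 1991 /
Burungale–Flach 2024 Thm 1.1 + Cor 2, tree fact `bsdTriple_of_hasCM_of_L_one_ne_zero`, EVERY prime
including `2`) applies. [cite: BurungaleFlach2024, Thm. 1.1 and Cor. 2 (p. 4)] [cite: Miller2011LMS, Def. 1.1] -/
theorem bsdp_two_curve36a1 (h12 : thm12_ranks_of_twists) (hCM : bsdTriple_of_hasCM_of_L_one_ne_zero)
    (hmod : hasEntireLFunction_rat)
    (Dt : ModularParametrizationData curve36a1 (curve36a1.conductorNorm ℤ))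
    (hopt : IsOptimalDatum curve36a1 Dt) (hcusp : CuspZeroNotInTwice curve36a1 Dt)
    {p : ℕ} (hp : p.Prime) (h24 : p % 24 = 23) : BSDp curve36a1 2 :=
  RowC8.bsdp hCM hmod ⟨hasCM_curve36a1, analyticRank_curve36a1_eq_zero h12 Dt hopt hcusp hp h24⟩

/-! ## §7 The theorem: `BSD(E^{(−pM)}, 2)` with `ord_{s=1} L = 1` for every globally minimal model -/

/-- **`2`-PART OF BSD FOR THE SHU–ZHAI TWISTS OF `36a1` (rank one).** Granted BY NAME Shu–Zhai 2021
Thm 1.2 (`h12`) and Thm 1.4 (`h14`), the CM rank-zero row C8 (`hCM`) and modularity (`hmod`); granted AS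
PRINTED the optimal parametrisation datum `Dt` of `36a1` with `f([0]) ∉ 2E(ℚ)` and odd Manin constant
(Shu–Zhai §5.2 Table row `36a1`): for every prime `p ≡ 23 (mod 24)`, every finite set `Q` of admissible
primes `≠ p` with every prime of `2N` split in `ℚ(√M)`, `M = ∏_{q∈Q} q*`, and EVERY globally minimal
model `W` of the twist `E^{(−pM)}`: `ord_{s=1} L(W, s) = 1` and `BSD(W, 2)`. The kernel supplies the
isogeny, (Tor), `p > 3`, `p ≡ 3 (4)`, both Heegner/splitting conditions at `K = ℚ(√−p)`, `BSD(36a1,2)`.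
[cite: ShuZhai2021, Thm. 1.2, Thm. 1.4 and Thm. 4.10 (arXiv:2102.11808 chunks p0003 L24–L45, p0013 L14–L26)]
[cite: BurungaleFlach2024, Thm. 1.1 and Cor. 2] [cite: Miller2011LMS, Def. 1.1] -/
theorem analyticRank_eq_one_and_bsdp_two_of_twist_curve36a1 (h12 : thm12_ranks_of_twists)
    (h14 : thm14_twoPartBSD_of_twists) (hCM : bsdTriple_of_hasCM_of_L_one_ne_zero)
    (hmod : hasEntireLFunction_rat)
    (Dt : ModularParametrizationData curve36a1 (curve36a1.conductorNorm ℤ))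
    (hopt : IsOptimalDatum curve36a1 Dt) (hcusp : CuspZeroNotInTwice curve36a1 Dt) (hc : ¬ (2 : ℤ) ∣ Dt.c)
    {p : ℕ} (hp : p.Prime) (h24 : p % 24 = 23)
    {Q : Finset ℕ} (hQ : ∀ q ∈ Q, IsAdmissible curve36a1 curve36a1' q ∧ q ≠ p)
    (hQM : AllPrimesSplitInSqrt (2 * curve36a1.conductorNorm ℤ) (∏ q ∈ Q, qStar q))
    (W : WeierstrassCurve ℚ) [W.IsElliptic] [W.IsGloballyMinimal]
    (hW : ∃ C : VariableChange ℚ,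
      C • curve36a1.quadraticTwist ((-(p : ℤ) * ∏ q ∈ Q, qStar q : ℤ) : ℚ) = W) :
    W.analyticRank = 1 ∧ BSDp W 2 := by
  have hS := thm12Setting_curve36a1 Dt hopt hcusp hp h24 hQ
  have hd : ((∏ q ∈ Q, qStar q : ℤ) : ℚ) ≠ 0 := by
    have h := P2.neg_p_mul_ne_zero_of_thm12Setting hS Q
      (fun q hq => by exact_mod_cast (hQ q hq).1.1.ne_zero)
    push_cast at h ⊢
    exact (mul_ne_zero_iff.mp h).2
  obtain ⟨WM, _, _, hWM⟩ := P2.exists_globallyMinimal_twist curve36a1 hd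
  exact (P2.bsdp_two_twists_of_shuZhai h12 h14 hmod hS hWM hW hc
    (allPrimesSplitInSqrt_two_mul_conductorNorm_curve36a1 hp h24) hQM
    (bsdp_two_curve36a1 h12 hCM hmod Dt hopt hcusp hp h24)).2

/-- **The `r = 0` sub-family: `E^{(−p)} ≅ y² = x³ − p³`, `p ≡ 23 (mod 24)` prime** — NO admissibility
datum: `ord_{s=1} L(W,s) = 1` and `BSD(W, 2)` for every globally minimal model `W` of `36a1^{(−p)}`.
[cite: ShuZhai2021, Thm. 1.2, Thm. 1.4 (r = 0) and §5.2 Table row 36a1] [cite: BurungaleFlach2024, Cor. 2] -/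
theorem analyticRank_eq_one_and_bsdp_two_of_twist_curve36a1_prime (h12 : thm12_ranks_of_twists)
    (h14 : thm14_twoPartBSD_of_twists) (hCM : bsdTriple_of_hasCM_of_L_one_ne_zero)
    (hmod : hasEntireLFunction_rat)
    (Dt : ModularParametrizationData curve36a1 (curve36a1.conductorNorm ℤ))
    (hopt : IsOptimalDatum curve36a1 Dt) (hcusp : CuspZeroNotInTwice curve36a1 Dt) (hc : ¬ (2 : ℤ) ∣ Dt.c)
    {p : ℕ} (hp : p.Prime) (h24 : p % 24 = 23)
    (W : WeierstrassCurve ℚ) [W.IsElliptic] [W.IsGloballyMinimal]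
    (hW : ∃ C : VariableChange ℚ, C • curve36a1.quadraticTwist (-(p : ℚ)) = W) :
    W.analyticRank = 1 ∧ BSDp W 2 := by
  refine analyticRank_eq_one_and_bsdp_two_of_twist_curve36a1 h12 h14 hCM hmod Dt hopt hcusp hc hp h24
    (Q := ∅) (fun q hq => absurd hq (Finset.notMem_empty q)) (allPrimesSplitInSqrt_prod_empty _) W ?_
  simpa using hW

/-- **The EXPLICIT two-parameter family**: `p ≡ 23 (mod 24)` prime, `Q` any finite set of primes
`q ≡ 5 (mod 12)` with `M = ∏ q ≡ 1 (mod 24)`, twist `E^{(−pM)} ≅ y² = x³ − (pM)³`: `ord_{s=1} L(W,s) = 1`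
and `BSD(W, 2)` for every globally minimal model `W` — admissibility and the `ℚ(√M)`-condition discharged
(`admissible_of_forall_mod_twelve`, `allPrimesSplitInSqrt_two_mul_conductorNorm_prod`).
[cite: ShuZhai2021, Thm. 1.2, Thm. 1.4, Def. 1.1 and §5.2 Table row 36a1] [cite: BurungaleFlach2024, Cor. 2] -/
theorem analyticRank_eq_one_and_bsdp_two_of_twist_curve36a1_explicit (h12 : thm12_ranks_of_twists)
    (h14 : thm14_twoPartBSD_of_twists) (hCM : bsdTriple_of_hasCM_of_L_one_ne_zero)
    (hmod : hasEntireLFunction_rat)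
    (Dt : ModularParametrizationData curve36a1 (curve36a1.conductorNorm ℤ))
    (hopt : IsOptimalDatum curve36a1 Dt) (hcusp : CuspZeroNotInTwice curve36a1 Dt) (hc : ¬ (2 : ℤ) ∣ Dt.c)
    {p : ℕ} (hp : p.Prime) (h24 : p % 24 = 23)
    {Q : Finset ℕ} (hQ : ∀ q ∈ Q, q.Prime ∧ q % 12 = 5) (hM : (∏ q ∈ Q, q) % 24 = 1)
    (W : WeierstrassCurve ℚ) [W.IsElliptic] [W.IsGloballyMinimal]
    (hW : ∃ C : VariableChange ℚ, C • curve36a1.quadraticTwist (-((p * ∏ q ∈ Q, q : ℕ) : ℚ)) = W) :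
    W.analyticRank = 1 ∧ BSDp W 2 := by
  refine analyticRank_eq_one_and_bsdp_two_of_twist_curve36a1 h12 h14 hCM hmod Dt hopt hcusp hc hp h24
    (admissible_of_forall_mod_twelve h24 hQ) (allPrimesSplitInSqrt_two_mul_conductorNorm_prod hQ hM) W ?_
  rw [prod_qStar_eq_of_forall_mod_twelve hQ]
  push_cast at hW ⊢
  simpa [neg_mul] using hW

/-! ## §8 Membership: the family lies inside the leaf (CM; analytic rank one) and in `CornerF♯` -/

/-- **`j = 0` on every model of every quadratic twist of `36a1`** (`j` is invariant under twists and
`ℚ`-isomorphisms). [cite: SilvermanAEC2009, X.5 Cor. 5.4] -/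
theorem j_eq_zero_of_smul_twist_curve36a1 {d : ℚ} (hd : d ≠ 0) {W : WeierstrassCurve ℚ} [W.IsElliptic]
    {C : VariableChange ℚ} (hC : C • curve36a1.quadraticTwist d = W) : W.j = 0 := by
  haveI := curve36a1.isElliptic_quadraticTwist hd
  subst hC
  rw [variableChange_j, j_quadraticTwist _ hd, curve36a1_j]

/-- **Every model of every quadratic twist of `36a1` has CM** (`j = 0`, CM by `ℤ[ζ₃]`).
[cite: SilvermanAEC2009, Appendix C §11, Example 11.3.1] -/
theorem hasCM_of_smul_twist_curve36a1 {d : ℚ} (hd : d ≠ 0) {W : WeierstrassCurve ℚ} [W.IsElliptic]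
    {C : VariableChange ℚ} (hC : C • curve36a1.quadraticTwist d = W) : W.HasCM :=
  hasCM_of_j_eq_zero _ (j_eq_zero_of_smul_twist_curve36a1 hd hC)

/-- **`2` is INERT in the CM field of every twist of `36a1`** (`K = ℚ(√−3)`, `d_K = −3 ≡ 5 (mod 8)`):
the family lies in the non-split half of the corner at `2` (seat p4's slices `WAllCornerFTwoInert*`,
sub-lane target `P2.CMNonsplitRankOneAtTwo`). [cite: Cox2013, §5.B Prop. 5.16] -/
theorem cmInert_two_of_smul_twist_curve36a1 {d : ℚ} (hd : d ≠ 0) {W : WeierstrassCurve ℚ} [W.IsElliptic]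
    [W.IsGloballyMinimal] {C : VariableChange ℚ} (hC : C • curve36a1.quadraticTwist d = W) : CMInert W 2 :=
  (cmInert_two_iff_of_hasCM (hasCM_of_smul_twist_curve36a1 hd hC)).2
    (Or.inl (by rw [j_eq_zero_of_smul_twist_curve36a1 hd hC]; simp [cmFieldDiscrOfJ]))

/-- **Membership.** Every globally minimal model `W` of a Shu–Zhai twist `36a1^{(−pM)}` is a point of the
leaf `WAllCornerFTwo`: CM and analytic rank one (the rank from Thm 1.2, `h12`); hence `CornerF W 2`, and
indeed the SHARP corner `CornerF♯ W 2` (`2` inert in `K = ℚ(√−3)`: never good ordinary at `2`;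
tree `cornerFSharp_two_iff_dvd_or_cmInert`). [cite: ShuZhai2021, Thm. 1.2] -/
theorem hasCM_and_analyticRank_eq_one_of_twist_curve36a1 (h12 : thm12_ranks_of_twists)
    (Dt : ModularParametrizationData curve36a1 (curve36a1.conductorNorm ℤ))
    (hopt : IsOptimalDatum curve36a1 Dt) (hcusp : CuspZeroNotInTwice curve36a1 Dt)
    {p : ℕ} (hp : p.Prime) (h24 : p % 24 = 23)
    {Q : Finset ℕ} (hQ : ∀ q ∈ Q, IsAdmissible curve36a1 curve36a1' q ∧ q ≠ p)
    (W : WeierstrassCurve ℚ) [W.IsElliptic] [W.IsGloballyMinimal]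
    (hW : ∃ C : VariableChange ℚ,
      C • curve36a1.quadraticTwist ((-(p : ℤ) * ∏ q ∈ Q, qStar q : ℤ) : ℚ) = W) :
    W.HasCM ∧ W.analyticRank = 1 ∧ CornerF W 2 ∧ CornerFSharp W 2 := by
  have hS := thm12Setting_curve36a1 Dt hopt hcusp hp h24 hQ
  have hd0 : ((-(p : ℤ) * ∏ q ∈ Q, qStar q : ℤ) : ℚ) ≠ 0 :=
    P2.neg_p_mul_ne_zero_of_thm12Setting hS Q (fun q hq => by exact_mod_cast (hQ q hq).1.1.ne_zero)
  have hd : ((∏ q ∈ Q, qStar q : ℤ) : ℚ) ≠ 0 := by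
    have h := hd0
    push_cast at h ⊢
    exact (mul_ne_zero_iff.mp h).2
  obtain ⟨C, hC⟩ := hW
  have hcm : W.HasCM := hasCM_of_smul_twist_curve36a1 hd0 hC
  obtain ⟨WM, _, _, hWM⟩ := P2.exists_globallyMinimal_twist curve36a1 hd
  obtain ⟨-, -, hr1, -, -, -⟩ := h12 curve36a1 Dt curve36a1' p Q hS WM W hWM ⟨C, hC⟩
  refine ⟨hcm, hr1, ⟨hcm, hr1, Or.inl rfl⟩, ?_⟩
  exact cornerFSharp_two_iff_dvd_or_cmInert.2
    ⟨hasCM_iff_j_mem_cmJInvariants.1 hcm, hr1, Or.inr (cmInert_two_of_smul_twist_curve36a1 hd0 hC)⟩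

/-! ## §9 The slices of the leaf `WAllCornerFTwo`, in LEAF SHAPE -/

/-- **SLICE SZ36 (in print).** In the shape of the leaf `Summit.BirchSwinnertonDyer.WAllCornerFTwo`
(`∀ W, W.HasCM → W.analyticRank = 1 → … → BSDp W 2`; the two leaf hypotheses are not used): every globally
minimal model of a Shu–Zhai twist `36a1^{(−pM)}` — `p ≡ 23 (mod 24)` prime, `Q` admissible primes `≠ p`
with every prime of `2N` split in `ℚ(√M)` — satisfies `BSD(W, 2)`, granted Shu–Zhai Thm 1.2 / 1.4, row
C8, modularity and Agashe–Ribet–Stein 2006 Thm 2.6 (odd — indeed trivial — Manin constant) BY NAME,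
and the two printed DISPLAY hypotheses on `36a1` (an optimal parametrisation datum `Dt`;
`f([0]) ∉ 2E(ℚ)`, Shu–Zhai §5.2 Table). Beyond print: NO. [cite: ShuZhai2021, Thm. 1.2, Thm. 1.4, §5.2 Table row 36a1]
[cite: AgasheRibetStein2006, Thm. 2.6]
[cite: BurungaleFlach2024, Thm. 1.1 and Cor. 2] [cite: Miller2011LMS, Def. 1.1] -/
theorem cornerFTwo_shuZhaiThirtySix (h12 : thm12_ranks_of_twists) (h14 : thm14_twoPartBSD_of_twists)
    (hCM : bsdTriple_of_hasCM_of_L_one_ne_zero) (hmod : hasEntireLFunction_rat)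
    (Dt : ModularParametrizationData curve36a1 (curve36a1.conductorNorm ℤ))
    (hopt : IsOptimalDatum curve36a1 Dt) (hcusp : CuspZeroNotInTwice curve36a1 Dt)
    (hARS : AgasheRibetStein2006.cremona_abs_maninConstant_eq_one_of_level_le) :
    ∀ (W : WeierstrassCurve ℚ) [W.IsElliptic] [W.IsGloballyMinimal], W.HasCM → W.analyticRank = 1 →
      ∀ (p : ℕ), p.Prime → p % 24 = 23 →
      ∀ (Q : Finset ℕ), (∀ q ∈ Q, IsAdmissible curve36a1 curve36a1' q ∧ q ≠ p) →
        AllPrimesSplitInSqrt (2 * curve36a1.conductorNorm ℤ) (∏ q ∈ Q, qStar q) →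
        ∀ (C : VariableChange ℚ),
          C • curve36a1.quadraticTwist ((-(p : ℤ) * ∏ q ∈ Q, qStar q : ℤ) : ℚ) = W → BSDp W 2 :=
  fun W _ _ _ _ _ hp h24 _ hQ hQM C hC =>
    (analyticRank_eq_one_and_bsdp_two_of_twist_curve36a1 h12 h14 hCM hmod Dt hopt hcusp
      (not_two_dvd_c_of_isOptimalDatum_curve36a1 hARS Dt hopt) hp h24 hQ hQM
      W ⟨C, hC⟩).2

/-- **SLICE SZ36₀ (in print, no admissibility datum).** In LEAF SHAPE: every globally minimal model of
`36a1^{(−p)}` (`≅ y² = x³ − p³`), `p ≡ 23 (mod 24)` prime, satisfies `BSD(W, 2)` — granted the same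
named facts and display hypotheses. Beyond print: NO. [cite: ShuZhai2021, Thm. 1.2, Thm. 1.4 (r = 0),
§5.2 Table row 36a1] [cite: BurungaleFlach2024, Cor. 2] [cite: Miller2011LMS, Def. 1.1] -/
theorem cornerFTwo_shuZhaiThirtySix_prime (h12 : thm12_ranks_of_twists) (h14 : thm14_twoPartBSD_of_twists)
    (hCM : bsdTriple_of_hasCM_of_L_one_ne_zero) (hmod : hasEntireLFunction_rat)
    (Dt : ModularParametrizationData curve36a1 (curve36a1.conductorNorm ℤ))
    (hopt : IsOptimalDatum curve36a1 Dt) (hcusp : CuspZeroNotInTwice curve36a1 Dt)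
    (hARS : AgasheRibetStein2006.cremona_abs_maninConstant_eq_one_of_level_le) :
    ∀ (W : WeierstrassCurve ℚ) [W.IsElliptic] [W.IsGloballyMinimal], W.HasCM → W.analyticRank = 1 →
      ∀ (p : ℕ), p.Prime → p % 24 = 23 →
        ∀ (C : VariableChange ℚ), C • curve36a1.quadraticTwist (-(p : ℚ)) = W → BSDp W 2 :=
  fun W _ _ _ _ _ hp h24 C hC =>
    (analyticRank_eq_one_and_bsdp_two_of_twist_curve36a1_prime h12 h14 hCM hmod Dt hopt hcusp
      (not_two_dvd_c_of_isOptimalDatum_curve36a1 hARS Dt hopt) hp h24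
      W ⟨C, hC⟩).2

/-- **SLICE SZ36-EXPLICIT (in print, every number-theoretic hypothesis a congruence).** In LEAF SHAPE:
for every prime `p ≡ 23 (mod 24)` and every finite set `Q` of primes `q ≡ 5 (mod 12)` with
`∏ q ≡ 1 (mod 24)`, every globally minimal model of `36a1^{(−p∏q)}` (`≅ y² = x³ − (p∏q)³`) satisfies
`BSD(W, 2)` — granted Shu–Zhai Thm 1.2 / 1.4, row C8, modularity BY NAME and the printed display
hypotheses on the optimal parametrisation of `36a1`. Beyond print: NO.
[cite: ShuZhai2021, Thm. 1.2, Thm. 1.4, Def. 1.1, §5.2 Table row 36a1] [cite: BurungaleFlach2024, Cor. 2]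
[cite: Miller2011LMS, Def. 1.1] -/
theorem cornerFTwo_shuZhaiThirtySix_explicit (h12 : thm12_ranks_of_twists) (h14 : thm14_twoPartBSD_of_twists)
    (hCM : bsdTriple_of_hasCM_of_L_one_ne_zero) (hmod : hasEntireLFunction_rat)
    (Dt : ModularParametrizationData curve36a1 (curve36a1.conductorNorm ℤ))
    (hopt : IsOptimalDatum curve36a1 Dt) (hcusp : CuspZeroNotInTwice curve36a1 Dt)
    (hARS : AgasheRibetStein2006.cremona_abs_maninConstant_eq_one_of_level_le) :
    ∀ (W : WeierstrassCurve ℚ) [W.IsElliptic] [W.IsGloballyMinimal], W.HasCM → W.analyticRank = 1 →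
      ∀ (p : ℕ), p.Prime → p % 24 = 23 →
      ∀ (Q : Finset ℕ), (∀ q ∈ Q, q.Prime ∧ q % 12 = 5) → (∏ q ∈ Q, q) % 24 = 1 →
        ∀ (C : VariableChange ℚ),
          C • curve36a1.quadraticTwist (-((p * ∏ q ∈ Q, q : ℕ) : ℚ)) = W → BSDp W 2 :=
  fun W _ _ _ _ _ hp h24 _ hQ hM C hC =>
    (analyticRank_eq_one_and_bsdp_two_of_twist_curve36a1_explicit h12 h14 hCM hmod Dt hopt hcusp
      (not_two_dvd_c_of_isOptimalDatum_curve36a1 hARS Dt hopt) hp h24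
      hQ hM W ⟨C, hC⟩).2

end Summit.BirchSwinnertonDyer.Rank1Residual.P2

end
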